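import Literature.AnabelianGeometry.SemiGraphs.ProSigmaCuspInertiaFreeCyclic
import Literature.AnabelianGeometry.SemiGraphs.ProSigmaCuspInertiaMalnormalHolds
import Literature.AnabelianGeometry.SemiGraphs.ProSigmaCompletionModels
import Literature.AnabelianGeometry.AbsoluteAnabelian.AbsTopII.FreeProcyclicBridge
import Literature.AnabelianGeometry.AbsoluteAnabelian.FundamentalExtension
import HarnessLib

/-!
# [AbsTopIII] Prop. 1.4 (i) "`I_x ≅ Ẑ(1)`" (F-2464 `IsFreeProcyclic`, F-0406 `InertiaFreeProcyclic`) at the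
# PROFINITE completion of every hyperbolic `Γ_{g,r}` — and its failure at pro-`Σ ⊊ 𝔓𝔯𝔦𝔪𝔢𝔰`

Mochizuki, *Topics in Absolute Anabelian Geometry III*, §1, Prop. 1.4 (i), manuscript p. 31 (lit key
`paper:url-5493eb38cbb7`): "the inertia group `I_x` of `x` in `Δ_U` is naturally isomorphic to `Ẑ(1)`";
[AbsTopII] Prop. 1.3 (i) p. 11 («`I_e ≅ Ẑ^Σ`»).  The cell types the group-theoretic content as
`FundamentalExtension.IsFreeProcyclic` (FACT-LIST F-2464: dense cyclic subgroup + an open subgroup of every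
positive index) and, on cuspidal data of an extension, `CuspidalData.InertiaFreeProcyclic` (F-0406); both
universal closures are REFUTED (junk data, `CuspidalData.not_forall_inertiaFreeProcyclic`), instances of
record: `CuspidalData.exists_prod_freeTwo_model` (`G × F̂₂`, hand-placed cusp; abc-iut-f-060) and the
`CurveModel` carriers of genus `1` / `g ≥ 2` (`…oncePuncturedTorus`, `…closedSurface`).

This PROOF-ONLY file (no definitions) states the row at the GENUINE SURFACE-GROUP CARRIER OF EVERY
HYPERBOLIC TYPE `(g, r)`: for a pro-`Σ` completion `ι : Γ_{g,r} → P` ([SemiAnbd] Ex. 2.10 interface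
`IsProSigmaCompletion`; abc-iut-L3) the closed cusp inertia subgroups `I_j := cl ι⟨c_j⟩` are free
pro-`Σ`-cyclic for every `Σ` (abc-iut-f-066, `isFreeProSigmaCyclic_cuspInertia_closure`, from abc-iut-L3-t4's
uniform cusp-order quotients), whence:

* `isFreeProcyclic_cuspInertia_closure` — **for `Σ = 𝔓𝔯𝔦𝔪𝔢𝔰` (the PROFINITE completion, print's `Δ_U`)
  every `I_j` IS free procyclic** (F-2464 at every cusp of every hyperbolic `(g, r)`);
* `not_isFreeProcyclic_cuspInertia_closure_of_not_mem` — **for a pro-`Σ` carrier with some prime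
  `q ∉ Σ` it is NOT** (`Ẑ^Σ ≇ Ẑ`; e.g. the pro-`l` smooth-curve data of `AbsTopICuspInertiaOfPSCSmoothCurve`):
  the row holds exactly at the full profinite inertia, as print intends;
* `CuspidalData.exists_surfaceGroup_inertiaFreeProcyclic` — the packaging as GENUINE CUSPIDAL DATA: on
  the extension `Π = P ↠ G = 1` the datum with cusps `Fin r` and `D_j = I_j = cl ι⟨c_j⟩` IS a
  `CuspidalData` (distinct cusps have non-conjugate groups — MALNORMALITY of cusp inertia,
  `proSigmaCuspInertiaMalnormal_holds`, abc-iut-L3) and satisfies **`InertiaFreeProcyclic` (F-0406)**;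
  `CuspidalData.exists_surfaceGroup_inertiaFreeProcyclic_of_isHyperbolicType` — such a carrier EXISTS for
  every hyperbolic `(g, r)` (`exists_isProSigmaCompletion`).

HONEST LABEL: group-theoretic carriers (pro-`Σ` completions of topological `π₁`'s over an algebraically
closed base, `G = 1`), not the étale `π₁` of a scheme with its Galois action (`Ẑ(1)` as a Galois MODULE is
not typed by the row either); instance ≠ endorsement; nothing here bears on [IUTchIII] Cor. 3.12.
-/

noncomputable section

open scoped Pointwise

namespace Literature.AnabelianGeometry.AbsoluteAnabelian

open Literature.GroupTheory.CombinatorialGroupTheory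
open Literature.AnabelianGeometry.SemiGraphs
open Literature.AnabelianGeometry.SemiGraphs.SemiGraphOfAnabelioids (IsProSigmaCompletion)

universe v

variable {P : Type v} [Group P] [TopologicalSpace P] [IsTopologicalGroup P] [CompactSpace P] [T2Space P]
  [TotallyDisconnectedSpace P] {g r : ℕ}

/-! ### F-2464 at the profinite completion, and its failure at pro-`Σ ⊊ 𝔓𝔯𝔦𝔪𝔢𝔰` -/

/-- **`I_j = cl ι⟨c_j⟩ ≅ Ẑ`** for the PROFINITE completion `ι : Γ_{g,r} → P` (`Σ` = all primes) of a
hyperbolic punctured surface group: free pro-`𝔓𝔯𝔦𝔪𝔢𝔰`-cyclic (`isFreeProSigmaCyclic_cuspInertia_closure`)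
means a dense cyclic subgroup and an open subgroup of every positive index, i.e. `IsFreeProcyclic`
([AbsTopIII] Prop. 1.4 (i) "`I_x ≅ Ẑ(1)`" with the Galois action forgotten, F-2464).
[cite: MochizukiAbsTopIII2015, Prop 1.4 (i) p.31] -/
theorem isFreeProcyclic_cuspInertia_closure (h : PuncturedSurfaceGroup.IsHyperbolicType g r)
    (ι : PuncturedSurfaceGroup g r →* P) (hι : IsProSigmaCompletion {p : ℕ | p.Prime} ι) (j : Fin r) :
    FundamentalExtension.IsFreeProcyclic
      ↥((PuncturedSurfaceGroup.cuspInertia (g := g) j).map ι).topologicalClosure := by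
  have hc := SemiGraphOfAnabelioids.isFreeProSigmaCyclic_cuspInertia_closure h ι hι j
  exact ⟨hc.exists_dense_zpowers, fun n hn => (hc.isOpen_index_iff n).mpr ⟨hn, fun p hp _ => hp⟩⟩

/-- **… and NOT free procyclic at a pro-`Σ` completion with some prime `q ∉ Σ`** (`I_j ≅ Ẑ^Σ` has no
open subgroup of index `q`): the typed row F-2464 holds at the full profinite inertia and fails at the
pro-`Σ` carriers, `Σ ⊊ 𝔓𝔯𝔦𝔪𝔢𝔰`. [cite: MochizukiAbsTopII2013, Prop 1.3 (i) p.11] -/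
theorem not_isFreeProcyclic_cuspInertia_closure_of_not_mem {Sigma : Set ℕ}
    (h : PuncturedSurfaceGroup.IsHyperbolicType g r) (ι : PuncturedSurfaceGroup g r →* P)
    (hι : IsProSigmaCompletion Sigma ι) {q : ℕ} (hq : q.Prime) (hqS : q ∉ Sigma) (j : Fin r) :
    ¬ FundamentalExtension.IsFreeProcyclic
      ↥((PuncturedSurfaceGroup.cuspInertia (g := g) j).map ι).topologicalClosure :=
  (SemiGraphOfAnabelioids.isFreeProSigmaCyclic_cuspInertia_closure h ι hι j).not_isFreeProcyclic hq hqS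

/-! ### F-0406: the packaging as genuine cuspidal data -/

/-- The two pointwise conjugation actions on subgroups agree: `MulAut.conj x • H = toConjAct x • H`.
[folklore] -/
private theorem mulAut_conj_smul_eq_toConjAct_smul {G : Type*} [Group G] (x : G) (H : Subgroup G) :
    MulAut.conj x • H = ConjAct.toConjAct x • H := by
  ext y
  rw [Subgroup.mem_smul_pointwise_iff_exists, Subgroup.mem_smul_pointwise_iff_exists]
  refine exists_congr fun h => and_congr_right fun _ => ?_
  rw [MulAut.smul_def, MulAut.conj_apply, ConjAct.toConjAct_smul]

/-- **F-0406 `InertiaFreeProcyclic` at the genuine surface-group carrier of type `(g, r)`.**  For the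
PROFINITE completion `ι : Γ_{g,r} → P` of a hyperbolic punctured surface group, the extension
`Π := P ↠ G := 1` (so `Δ = Π`) carries the cuspidal datum with cusps `Fin r` and decomposition = inertia
groups `D_j = I_j = cl ι⟨c_j⟩` — a legitimate `CuspidalData` because DISTINCT cusps have NON-CONJUGATE
inertia (malnormality of cusp inertia in pro-`Σ` surface groups, `proSigmaCuspInertiaMalnormal_holds`:
`I_i ∩ x I_j x⁻¹ = 1` for `i ≠ j`, while each `I_j` is infinite) — and this datum satisfies
`InertiaFreeProcyclic`: every `I_j ≅ Ẑ`. [cite: MochizukiAbsTopIII2015, Prop 1.4 (i) p.31] -/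
theorem FundamentalExtension.CuspidalData.exists_surfaceGroup_inertiaFreeProcyclic
    (h : PuncturedSurfaceGroup.IsHyperbolicType g r) (ι : PuncturedSurfaceGroup g r →* P)
    (hι : IsProSigmaCompletion {p : ℕ | p.Prime} ι) :
    ∃ C : FundamentalExtension.CuspidalData
        { arith := ProfiniteGrp.of P, gal := ProfiniteGrp.of PUnit.{v + 1}, aug := 1,
          aug_surjective := fun _ => ⟨1, rfl⟩ },
      ∃ e : C.Cusp ≃ Fin r,
        (∀ x, C.Dcusp x = ((PuncturedSurfaceGroup.cuspInertia (g := g) (e x)).map ι).topologicalClosure) ∧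
        (∀ x, C.Icusp x = ((PuncturedSurfaceGroup.cuspInertia (g := g) (e x)).map ι).topologicalClosure) ∧
        C.InertiaFreeProcyclic := by
  classical
  set E : FundamentalExtension.{v} :=
    { arith := ProfiniteGrp.of P, gal := ProfiniteGrp.of PUnit.{v + 1}, aug := 1,
      aug_surjective := fun _ => ⟨1, rfl⟩ } with hE
  have hgeom : E.geom = ⊤ := by
    rw [eq_top_iff]
    intro x _
    rw [FundamentalExtension.mem_geom]
  -- the cusp inertia closures and their malnormality
  let I : Fin r → Subgroup P := fun j => ((PuncturedSurfaceGroup.cuspInertia (g := g) j).map ι).topologicalClosure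
  have hmal := SemiGraphOfAnabelioids.proSigmaCuspInertiaMalnormal_holds.{v} {p : ℕ | p.Prime} ⟨2, Nat.prime_two⟩ (fun p hp => hp)
    g r h P ι hι
  let C : E.CuspidalData :=
    { Cusp := ULift.{v} (Fin r)
      Dcusp := fun j => I j.down
      Icusp := fun j => I j.down ⊓ E.geom
      Icusp_eq := fun _ => rfl
      isClosed_Dcusp := fun j => Subgroup.isClosed_topologicalClosure _
      eq_of_conj := fun i j x hx => by
        by_contra hij
        have hij' : j.down ≠ i.down := fun h' => hij (ULift.ext _ _ h'.symm)
        have h1 := (hmal j.down i.down).2 x (Or.inl hij')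
        change I j.down ⊓ ConjAct.toConjAct x • I i.down = ⊥ at h1
        have hx' : ConjAct.toConjAct x • I i.down = I j.down := by
          rw [← mulAut_conj_smul_eq_toConjAct_smul]; exact hx
        rw [hx', inf_idem] at h1
        have hinf := (hmal j.down j.down).1
        change Infinite (I j.down) at hinf
        rw [h1] at hinf
        exact not_finite (⊥ : Subgroup P) }
  refine ⟨C, Equiv.ulift, fun _ => rfl, fun j => ?_, fun j => ?_⟩
  · change I j.down ⊓ E.geom = I j.down
    rw [hgeom, inf_top_eq]
  · change FundamentalExtension.IsFreeProcyclic ↥(I j.down ⊓ E.geom)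
    rw [hgeom, inf_top_eq]
    exact isFreeProcyclic_cuspInertia_closure h ι hι j.down

/-- **Hence a GENUINE carrier of F-0406 exists for every hyperbolic type `(g, r)`**: the profinite
completion of `Γ_{g,r}` ([SemiAnbd] Ex. 2.10, `exists_isProSigmaCompletion`) with its `r` cusps — the
row `InertiaFreeProcyclic` is INHABITED by genuine cuspidal data with `r` cusps for every `r ≥ 1` (and
`2g − 2 + r > 0`), in particular by the tripod `(0, 3)` and the once-punctured torus `(1, 1)`.
[cite: MochizukiAbsTopIII2015, Prop 1.4 (i) p.31] -/
theorem FundamentalExtension.CuspidalData.exists_surfaceGroup_inertiaFreeProcyclic_of_isHyperbolicType (g r : ℕ)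
    (h : PuncturedSurfaceGroup.IsHyperbolicType g r) :
    ∃ (Q : ProfiniteGrp.{0}) (ι : PuncturedSurfaceGroup g r →* Q) (_ : IsProSigmaCompletion {p : ℕ | p.Prime} ι)
      (E : FundamentalExtension.{0}) (C : E.CuspidalData) (e : C.Cusp ≃ Fin r),
        E.arith = Q ∧ E.geom = ⊤ ∧ Nat.card C.Cusp = r ∧
        (∀ x, FundamentalExtension.IsFreeProcyclic
          ↥((PuncturedSurfaceGroup.cuspInertia (g := g) (e x)).map ι).topologicalClosure) ∧
        C.InertiaFreeProcyclic := by
  obtain ⟨Q, ι, hι⟩ :=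
    SemiGraphOfAnabelioids.IsProSigmaCompletion.exists_isProSigmaCompletion (PuncturedSurfaceGroup g r)
      {p : ℕ | p.Prime}
  obtain ⟨C, e, -, -, hC⟩ :=
    FundamentalExtension.CuspidalData.exists_surfaceGroup_inertiaFreeProcyclic (P := Q) h ι hι
  refine ⟨Q, ι, hι, _, C, e, rfl, ?_, ?_, fun x => isFreeProcyclic_cuspInertia_closure h ι hι (e x), hC⟩
  · rw [eq_top_iff]
    intro x _
    rw [FundamentalExtension.mem_geom]
  · rw [Nat.card_congr e, Nat.card_eq_fintype_card, Fintype.card_fin]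

end Literature.AnabelianGeometry.AbsoluteAnabelian
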